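import Mathlib
import Summits.AtomisticToContinuum.HydrodynamicLimit.Theorems.ImplosionDichotomyDenseExcursionPackingAnalyticDefsC
import Summits.AtomisticToContinuum.HydrodynamicLimit.Theorems.ImplosionDichotomyDenseExcursionPackingAnalyticCentreWBound
import Summits.AtomisticToContinuum.HydrodynamicLimit.Theorems.ImplosionDichotomyDenseExcursionPackingAnalyticDerivRecoveryWeighted

/-!
# The linear step of the hierarchy of `Γ` under `PackingResolventW`: the TWO-SCALE SIZES of the order-`k` solution
# (crux `DenseExcursion`, stmt-AtomisticToContinuum-12586, line `sonic-cavity-renewal` v8, stub `stub_analyticPackingImplosion`)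

Helper file (`--supports stmt-AtomisticToContinuum-12586`, line lead a2, wave-4 worker D1, task (0): THE CLOSURE DECISION,
kernel-checked in its linear half). Under the v8 linear input `PackingResolventW` (gain `1/k` only in the weighted size
`|u₁|/(1+S) + |u₂|/S`; no gain for the `w`-component in the acoustic layer `R ≍ s₀/(kμ)` at the centre) the majorant
closure of the W6 plan SURVIVES with the following bookkeeping. Measure the order-`k` source `f = Src_k` by the mixed norm
`N ≥ |f₁|/(1 + S) + |f₁|/k + |f₂|/S` (the `w`-source in the two weights `1/(1+S)` and `1/k`, the `s`-source over `S`).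
Then the order-`k` solution `X_k = (u₁, u₂)`, `v = u₂/S`, has, for `k ≥ k₀` and with ONE constant `C`:

* weighted size `k·(|u₁|/(1+S) + |v|) ≤ C N` (the hypothesis), unweighted `|u₁| ≤ C N` (`centre_w_bound`: from the
  weighted gain and the equations, the `w`-source entering as `N₁/k ≤ N`), and OFF the sonic window `|x| ≥ ρ₁`:
  `|u₁′| + (1 + S)|v′| ≤ C N` (`derivRecovery_offSonic_weighted`) and the ONE `k`-lossy size `(1 + S)²|v′| ≤ C N k`
  (`derivRecovery_offSonic`; genuinely `≍ kμ|u₁|/3` in the acoustic layer).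

These are exactly the pointwise densities consumed by `packingSources_bound_weighted` with `ω = 1/(1+S)` and `ω = 1/k`
(`T_i ≥ |w_i| + |w_i′| + |v_i| + (1 + ωS²)|v_i′|`, both `≤ 3C·N_i` since `S²/(1+S) ≤ 1 + S` and `S²/k·|v′| ≤ C N_i`), whose
right-hand side is the structured majorant of `majorant_shift`/`analytic_majorant_seeded`: the recursion
`N_k ≤ 3·Σ_{n ∈ Ico 2 (k+1)} a_n [Gᵏ](Σ_i 3C N_i Gⁱ)ⁿ` is GEOMETRIC (no factor `k` compounds). Kernel-checked here:

* `twoScale_linear_step` (REGISTERED helper): the statement above, for a monatomic cavity-tube profile with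
  `PackingResolventW`, at every order `k ≥ 1` (existence, regularity, global finiteness from `PackingResolventW`; the four
  size bounds for `k ≥ k₀`).

NOT here: the sonic window `|x| < ρ₁` (where `S ≍ 1` and the weights are immaterial; task (1)), the summation, or `Γ`.
-/

noncomputable section

open Set
open scoped ContDiff Topology

namespace Summit.AtomisticToContinuum.HydrodynamicLimit.Theorems.PackingAnalyticImplosion

open Summit.AtomisticToContinuum.HydrodynamicLimit.Theorems.R2OneModeTwoConditions
open Summit.AtomisticToContinuum.HydrodynamicLimit.Theorems.SonicCavityRenewal

/-- Real differentiability of a real function whose complex coercion is smooth. [folklore] -/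
theorem differentiable_of_coe_contDiff {u : ℝ → ℝ} (h : ContDiff ℝ ∞ (fun x => (u x : ℂ))) : Differentiable ℝ u := by
  have h2 : Differentiable ℝ (fun x => Complex.reCLM ((u x : ℂ))) :=
    Complex.reCLM.differentiable.comp (h.differentiable (by simp))
  simpa using h2

/-- **THE LINEAR STEP IN THE TWO-SCALE SIZES** (registered helper `twoScale_linear_step` of
`stub_analyticPackingImplosion`): for `0 < ρ₁ ≤ 1` and a monatomic cavity-tube profile with `PackingResolventW` there are
`k₀` and ONE constant `C` such that at every order `k ≥ 1` every smooth centre-regular real source with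
`|f₁|/(1+S) + |f₁|/k + |f₂|/S ≤ N` has a smooth centre-regular real solution of `kμ·u − Lu = f` with finite global
weighted sup, and for `k ≥ k₀`: `k(|u₁|/(1+S) + |u₂|/S) ≤ CN`, `|u₁| ≤ CN` everywhere, and at every `|y| ≥ ρ₁`,
`|u₁′| + (1+S)|(u₂/S)′| ≤ CN` and `(1+S)²|(u₂/S)′| ≤ CN·k`. [folklore] -/
theorem twoScale_linear_step : ∀ (r : ℝ) (W S : ℝ → ℝ) (ρ₁ : ℝ), 0 < ρ₁ → ρ₁ ≤ 1 → IsMonatomicProfile r W S → CavityTube r W S → PackingResolventW r W S → ∃ (k₀ : ℕ) (C : ℝ), 0 < C ∧ ∀ k : ℕ, 1 ≤ k → ∀ f₁ f₂ : ℝ → ℝ, IsRegularPair (fun x => (f₁ x : ℂ)) (fun x => (f₂ x : ℂ)) → ∀ N : ℝ, (∀ y, |f₁ y| / (1 + S y) + |f₁ y| / k + |f₂ y| / S y ≤ N) → ∃ u₁ u₂ : ℝ → ℝ, IsRegularPair (fun x => (u₁ x : ℂ)) (fun x => (u₂ x : ℂ)) ∧ (∀ x, (((k : ℝ) * (3 *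 (r - 1)) : ℝ) : ℂ) * (u₁ x : ℂ) - linW r W S (fun y => (u₁ y : ℂ)) (fun y => (u₂ y : ℂ)) x = (f₁ x : ℂ) ∧ (((k : ℝ) * (3 * (r - 1)) : ℝ) : ℂ) * (u₂ x : ℂ) - linS r W S (fun y => (u₁ y : ℂ)) (fun y => (u₂ y : ℂ)) x = (f₂ x : ℂ)) ∧ (∃ N' : ℝ, ∀ y, |u₁ y| + |u₂ y| / S y ≤ N') ∧ (k₀ ≤ k → ∀ y, (k : ℝ) * (|u₁ y| / (1 + S y) + |u₂ y| / S y) ≤ C * N ∧ |u₁ y| ≤ C * N ∧ (ρ₁ ≤ |y| → |deriv u₁ y| + (1 + S y) * |deriv (fun z => u₂ z / S z) y| ≤ C * N ∧ (1 + S y) ^ 2 * |deriv (fun z => u₂ z / S z) y| ≤ C * N * k)) := by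
  intro r W S ρ₁ hρ₁ hρ₁1 hP hT hR
  obtain ⟨k₀, CR, hCR, hres⟩ := hR
  obtain ⟨Cc, hCc, hcen⟩ := centre_w_bound r W S hP hT
  obtain ⟨C₁, hC₁, hrec1⟩ := derivRecovery_offSonic_weighted r W S ρ₁ hρ₁ hρ₁1 hP hT
  obtain ⟨C₂, hC₂, hrec2⟩ := derivRecovery_offSonic r W S ρ₁ hρ₁ hρ₁1 hP hT
  have hr1 : 1 < r := hP.1
  have hSpos : ∀ x, 0 < S x := hP.2.2.2.2.1
  obtain ⟨μ, hμ⟩ : ∃ μ : ℝ, μ = 3 * (r - 1) := ⟨_, rfl⟩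
  have hμpos : 0 < μ := by rw [hμ]; linarith
  -- THE CONSTANTS
  obtain ⟨CB, hCB⟩ : ∃ CB : ℝ, CB = Cc * (CR * (μ + 1) + 1 + 1 / μ) := ⟨_, rfl⟩
  have hCB0 : 0 < CB := by rw [hCB]; positivity
  obtain ⟨CW, hCW⟩ : ∃ CW : ℝ, CW = C₁ * (CR * (μ + 1) + CB + 1) := ⟨_, rfl⟩
  have hCW0 : 0 < CW := by rw [hCW]; positivity
  obtain ⟨CD, hCD⟩ : ∃ CD : ℝ, CD = C₂ * ((μ + 1) * (CB + CR) + 2) := ⟨_, rfl⟩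
  have hCD0 : 0 < CD := by rw [hCD]; positivity
  refine ⟨k₀, CR + CB + CW + 2 * CD, by positivity, ?_⟩
  intro k hk f₁ f₂ hf N hN
  have hk1 : (1 : ℝ) ≤ k := by exact_mod_cast hk
  have hk0 : (0 : ℝ) < k := by linarith
  -- the three source norms
  have hN0 : 0 ≤ N := by
    have h := hN 0
    have h0 := hSpos 0
    have : 0 ≤ |f₁ 0| / (1 + S 0) + |f₁ 0| / k + |f₂ 0| / S 0 := by positivity
    linarith
  have hNw : ∀ y, |f₁ y| / (1 + S y) + |f₂ y| / S y ≤ N := fun y => by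
    have h := hN y
    have : 0 ≤ |f₁ y| / k := by positivity
    linarith
  have hN1 : ∀ y, |f₁ y| ≤ N * k := fun y => by
    have h := hN y
    have hy := hSpos y
    have h1 : 0 ≤ |f₁ y| / (1 + S y) := by positivity
    have h2 : 0 ≤ |f₂ y| / S y := by positivity
    have h3 : |f₁ y| / k ≤ N := by linarith
    rwa [div_le_iff₀ hk0] at h3
  have hN2 : ∀ y, |f₂ y| / S y ≤ N := fun y => by
    have h := hN y
    have hy := hSpos y
    have h1 : 0 ≤ |f₁ y| / (1 + S y) := by positivity
    have h2 : 0 ≤ |f₁ y| / k := by positivity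
    linarith
  -- the solution from `PackingResolventW`
  obtain ⟨u₁, u₂, hu, hsol, hN', hgain⟩ := hres k hk f₁ f₂ hf N hNw
  refine ⟨u₁, u₂, hu, hsol, hN', fun hk₀ y => ?_⟩
  obtain ⟨hwg, -⟩ := hgain hk₀
  have hu₁d : Differentiable ℝ u₁ := differentiable_of_coe_contDiff hu.1
  have hu₂d : Differentiable ℝ u₂ := differentiable_of_coe_contDiff hu.2.1
  have hE := fun x => resolventEqs_real (r := r) (Λ := (k : ℝ) * (3 * (r - 1))) hu₁d hu₂d hsol x
  rw [← hμ] at hE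
  have hΛ0 : 0 ≤ (k : ℝ) * μ := by positivity
  -- the weighted gain `a = CR N / k`
  have ha : ∀ z, |u₁ z| / (1 + S z) + |u₂ z| / S z ≤ CR * N / k := hwg
  have hkμ : (k : ℝ) * μ + 1 ≤ (μ + 1) * k := by linarith
  have hCRN : 0 ≤ CR * N := mul_nonneg hCR.le hN0
  have haΛ : ((k : ℝ) * μ + 1) * (CR * N / k) ≤ CR * (μ + 1) * N := by
    have e : ((k : ℝ) * μ + 1) * (CR * N / k) = CR * N * ((k : ℝ) * μ + 1) / k := by ring
    rw [e, div_le_iff₀ hk0]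
    have h := mul_le_mul_of_nonneg_left hkμ hCRN
    linarith
  -- (ii) the unweighted `w`-bound at the centre
  have hB : ∀ z, |u₁ z| ≤ CB * N := by
    intro z
    obtain ⟨N', hN''⟩ := hN'
    have hglob : ∃ B : ℝ, ∀ x, |u₁ x| ≤ B := ⟨N', fun x => by
      have h := hN'' x
      have : 0 ≤ |u₂ x| / S x := by have := hSpos x; positivity
      linarith⟩
    have h := hcen ((k : ℝ) * μ) (CR * N / k) (N * k) N u₁ u₂ f₁ f₂ hΛ0 hu₁d hE hglob ha hN1 hN2 z
    have h2 : N * k / ((k : ℝ) * μ + 1) ≤ N / μ := by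
      rw [div_le_div_iff₀ (by positivity) hμpos]
      linarith
    have h3 : ((k : ℝ) * μ + 1) * (CR * N / k) + N + N * k / ((k : ℝ) * μ + 1) ≤
        (CR * (μ + 1) + 1 + 1 / μ) * N := by
      have e : (CR * (μ + 1) + 1 + 1 / μ) * N = CR * (μ + 1) * N + N + N / μ := by ring
      rw [e]; linarith
    calc |u₁ z| ≤ Cc * (((k : ℝ) * μ + 1) * (CR * N / k) + N + N * k / ((k : ℝ) * μ + 1)) := h
      _ ≤ Cc * ((CR * (μ + 1) + 1 + 1 / μ) * N) := mul_le_mul_of_nonneg_left h3 hCc.le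
      _ = CB * N := by rw [hCB]; ring
  have q1 : 0 ≤ CR * N := hCRN
  have q2 : 0 ≤ CB * N := by positivity
  have q3 : 0 ≤ CW * N := by positivity
  have q4 : 0 ≤ CD * N := by positivity
  have q5 : 0 ≤ (CR + CB + CW) * N * k := by positivity
  refine ⟨?_, ?_, fun hy => ⟨?_, ?_⟩⟩
  · -- (i) the weighted gain
    have h := ha y
    have e : (k : ℝ) * (CR * N / k) = CR * N := by field_simp
    calc (k : ℝ) * (|u₁ y| / (1 + S y) + |u₂ y| / S y) ≤ (k : ℝ) * (CR * N / k) :=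
          mul_le_mul_of_nonneg_left h hk0.le
      _ = CR * N := e
      _ ≤ (CR + CB + CW + 2 * CD) * N := by linarith
  · -- (ii)
    calc |u₁ y| ≤ CB * N := hB y
      _ ≤ (CR + CB + CW + 2 * CD) * N := by linarith
  · -- (iii) the weighted recovery off the window
    have h := hrec1 ((k : ℝ) * μ) u₁ u₂ f₁ f₂ y hy (hu₂d y) (hE y).1 (hE y).2
    rw [abs_of_nonneg hΛ0] at h
    have h4 : ((k : ℝ) * μ + 1) * (|u₁ y| / (1 + S y) + |u₂ y| / S y) + |u₁ y| +
        (|f₁ y| / (1 + S y) + |f₂ y| / S y) ≤ (CR * (μ + 1) + CB + 1) * N := by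
      have h5 : ((k : ℝ) * μ + 1) * (|u₁ y| / (1 + S y) + |u₂ y| / S y) ≤ ((k : ℝ) * μ + 1) * (CR * N / k) :=
        mul_le_mul_of_nonneg_left (ha y) (by positivity)
      linarith [hB y, hNw y]
    calc _ ≤ C₁ * (((k : ℝ) * μ + 1) * (|u₁ y| / (1 + S y) + |u₂ y| / S y) + |u₁ y| +
          (|f₁ y| / (1 + S y) + |f₂ y| / S y)) := h
      _ ≤ C₁ * ((CR * (μ + 1) + CB + 1) * N) := mul_le_mul_of_nonneg_left h4 hC₁.le
      _ = CW * N := by rw [hCW]; ring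
      _ ≤ (CR + CB + CW + 2 * CD) * N := by linarith
  · -- (iv) the one `k`-lossy size
    have h := hrec2 ((k : ℝ) * μ) u₁ u₂ f₁ f₂ y hy (hu₂d y) (hE y).1 (hE y).2
    rw [abs_of_nonneg hΛ0] at h
    have hS := hSpos y
    have hv0 : 0 ≤ |deriv (fun z => u₂ z / S z) y| := abs_nonneg _
    have hu₂S : |u₂ y| / S y ≤ CR * N / k := by
      have : 0 ≤ |u₁ y| / (1 + S y) := by positivity
      linarith [ha y]
    have h6 : ((k : ℝ) * μ + 1) * (|u₁ y| + |u₂ y| / S y) + (|f₁ y| + |f₂ y| / S y) ≤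
        ((μ + 1) * (CB + CR) + 2) * N * k := by
      have h7 : ((k : ℝ) * μ + 1) * (|u₁ y| + |u₂ y| / S y) ≤ ((k : ℝ) * μ + 1) * (CB * N + CR * N / k) :=
        mul_le_mul_of_nonneg_left (add_le_add (hB y) hu₂S) (by positivity)
      have h10 : ((k : ℝ) * μ + 1) * (CB * N) ≤ (μ + 1) * k * (CB * N) := mul_le_mul_of_nonneg_right hkμ q2
      have h9 : ((k : ℝ) * μ + 1) * (CR * N / k) ≤ (μ + 1) * k * (CR * N) := by
        have hk' : ((k : ℝ) * μ + 1) / k ≤ (μ + 1) * k := by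
          rw [div_le_iff₀ hk0]
          have hmk : 0 ≤ (μ + 1) * k := by positivity
          nlinarith only [hkμ, hk1, hmk]
        have e : ((k : ℝ) * μ + 1) * (CR * N / k) = ((k : ℝ) * μ + 1) / k * (CR * N) := by ring
        rw [e]
        exact mul_le_mul_of_nonneg_right hk' q1
      have h11 : |f₁ y| + |f₂ y| / S y ≤ 2 * N * k := by
        have hNk : N ≤ N * k := le_mul_of_one_le_right hN0 hk1
        linarith [hN1 y, hN2 y]
      have e2 : ((k : ℝ) * μ + 1) * (CB * N + CR * N / k) =
          ((k : ℝ) * μ + 1) * (CB * N) + ((k : ℝ) * μ + 1) * (CR * N / k) := by ring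
      have e3 : ((μ + 1) * (CB + CR) + 2) * N * k = (μ + 1) * k * (CB * N) + (μ + 1) * k * (CR * N) + 2 * N * k := by
        ring
      rw [e3]
      linarith only [h7, h10, h9, h11, e2]
    have hD : (1 + S y ^ 2) * |deriv (fun z => u₂ z / S z) y| ≤ CD * N * k := by
      have h12 : (1 + S y ^ 2) * |deriv (fun z => u₂ z / S z) y| ≤
          C₂ * (((k : ℝ) * μ + 1) * (|u₁ y| + |u₂ y| / S y) + (|f₁ y| + |f₂ y| / S y)) := by
        linarith [abs_nonneg (deriv u₁ y)]
      calc _ ≤ C₂ * (((k : ℝ) * μ + 1) * (|u₁ y| + |u₂ y| / S y) + (|f₁ y| + |f₂ y| / S y)) := h12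
        _ ≤ C₂ * (((μ + 1) * (CB + CR) + 2) * N * k) := mul_le_mul_of_nonneg_left h6 hC₂.le
        _ = CD * N * k := by rw [hCD]; ring
    have hw : (1 + S y) ^ 2 ≤ 2 * (1 + S y ^ 2) := by nlinarith only [sq_nonneg (S y - 1)]
    calc (1 + S y) ^ 2 * |deriv (fun z => u₂ z / S z) y| ≤ 2 * (1 + S y ^ 2) * |deriv (fun z => u₂ z / S z) y| :=
          mul_le_mul_of_nonneg_right hw hv0
      _ ≤ 2 * (CD * N * k) := by linarith
      _ ≤ (CR + CB + CW + 2 * CD) * N * k := by linarith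

end Summit.AtomisticToContinuum.HydrodynamicLimit.Theorems.PackingAnalyticImplosion

end
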